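import Literature.MathematicalPhysics.QuantumFieldTheory.Balaban1983to89.B9Cor36SiteSandwichTransfer
import Literature.MathematicalPhysics.QuantumFieldTheory.Balaban1983to89.B9Cor36BondSandwichTransferSrc

/-!
# `Balaban1983to89.B9Cor36SiteSandwichTransferSrcGlobal` — THE SITE-SECTOR SANDWICH TRANSFER FROM THE CUBE SEQUENCE's BLOCKS TO THE MEMBER's BLOCKS FOR WORDS
# WITH NO SOURCE CUT-OFF NEAR □: `conj b(M_{g₁}∘R(γ)⁻¹∘M∘R(γ)) ≺ (M₂Σ‖b‖)²·K` over the member from `conj b(M) ≺ B_C·w(a)·e^{−δd_□}` over the cube sequence,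
# paying ONE [4]-(2.61) sum for the splitting of a member source block into cube blocks (the site-sector twin of the bond-sector
# `B9Cor36BondSandwichTransferSrc.hasMajorant_conj_bond_sandwich_src_global`; sub-row G-B9-LETTERS, GAPS G-B9-05 family 3 of (3.105) — the named missing
# piece for the in-tree discharge of the displayed input D1-left of the FAMTHREE files)

T. Bałaban, *Propagators for lattice gauge theories in a background field*, Commun. Math. Phys. **99** (1985) 389–434
[`Balaban1985BackgroundPropagators`, "B9"] (held `paper:balaban1985-cmp99-background-propagators`; journal page = PDF page + 388); [4] = T. Bałaban,
*Propagators and renormalization transformations for lattice gauge theories. II*, Commun. Math. Phys. **96** (1984) 223–250 [`Balaban1984PropagatorsII`].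

statement-level skeleton of published theorems with citation tags; proofs where landed; nothing here is a claim about the
Yang–Mills mass gap

THE PRINTED LOCUS (verbatim up to notation; page owner r06).  [B9] Cor. 3.6 p. 408 l. 11–14 («Let us take a cube □ ∈ 𝒟_j and let us define a sequence
{Ω_n(□)}_{n=0,…,j+1} … Ω_n(□) is a cube with a center at the center of □ …»); p. 409 l. 1–5 («The operators constructed for this sequence, which we denote
by G′_□(U), C_□(U), G_□(U), satisfy all the inequalities of Theorems 3.1–3.3 correspondingly. This is the basis of all estimates for the expansions we will
construct»); (3.105) pp. 414–415 (the random-walk expansion of `G′(U)` about the cube operators `G′_□`, whose third family carries the cube letter `G′_□(V′)`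
with rows cut off near □̃ by `ζ_□·D` but with NO cut-off at the source end); [4] (2.46) p. 231 (the scaled distance), (2.51)–(2.52) p. 232 («|(Tλ)(x)| ≦
K(y,y′)|λ|», «this property is preserved under the composition of operators possessing it»), Lemma 2.1 (2.61) p. 234 («Σ_{y′} e^{−αδ₀d(y,y′)} ≦ c₁»).

WHY THIS FILE (cell `lit-balaban`; seat p21 gen 58; lead g34 WAKE `lit-balaban-p21/WAKE-B9FamThreeSiteSrcGlobal.md` 2026-08-29T00:23:08Z + RULING FAMTHREE-2
00:30:17Z: «the site `_src_global` twin … stays commissioned as the named missing piece for a later in-tree discharge of D1-left»; p33 g102 scoping memo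
`lit-balaban-p33/g102/FAMTHREE-SCOPE.md` v2 §7(b)∕(c)).  p38's `B9Cor36SiteSandwichTransfer.hasMajorant_conj_site_sandwich` carries a cube-side block majorant of
`conj b(M)` to the member's blocks for SITE-sector sandwiches `M_{g₁}R(γ)⁻¹MR(γ)M_{g₂}` whose SOURCE cut-off `g₂` lives near □ — there a member block IS a cube
block (`blkCubeY_eq_of_blkOf_eq_of_nearH`).  The cube letter `G′_□(V′)` of the third family of (3.105) (and the located difference `M_χ∘(G′(U) − G′_□(V′))` of
p33 g103's D1-left) has its ROWS near □ but a GLOBAL source: away from `C₁(□)` the cube sequence has level `0` (r05 `lev_cubeFam_eq_zero`), so one member source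
block `Δ(y′)` splits into many cube blocks.  p38's bond-sector `B9Cor36BondSandwichTransferSrc.hasMajorant_conj_bond_sandwich_src_global` proves the transfer in
that generality for BOND carriers; THIS FILE is its letter-by-letter transplant to the SITE carrier `SiteY i` (block maps `(z, j) ↦ Δ_□(z)` on the cube side,
`(z, j) ↦ ιB(Δ(z))` on the member side): a member source `μ` supported in `Δ(y′)` is split into its cube-block pieces `μ = Σ_s μ|_s` (each a cube-side source
with the same bound; `R(γ)` contracts), the cube-side majorant bounds each piece by `B_C·w(a)·e^{−δd_□(a,s)}`, the pieces not under `y′` vanish, the others have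
`d(a,y′) ≤ d_□(a,s)` (p38's `dist_member_le_dist_cube`), and `e^{−δd_□} ≤ e^{−(1−α)δd(a,y′)}·e^{−αδd_□(a,s)}` (p38's `exp_split_le`) leaves ONE sum
`Σ_s e^{−αδd_□(a,s)} ≤ c₁(δ,α)` — [4] (2.61) on the cube geometry (p33's `exists_h261_geoCK` supplies it).  §2 reads it in the decay shape of record.

WHAT THIS FILE PROVES (THEOREMS; 0 `def`, 0 `def … : Prop`, 0 sorry; standard axioms).
* §1 ★★★ `hasMajorant_conj_site_sandwich_src_global` — for a bi-contractive unit field `γ` on sites, a real row multiplier `|g₁| ≤ G₁∘Δ_□`, a cube-side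
  majorant `conj b(M) ≺ B_C·w(a)·e^{−δ·d_□(a,s)}` over `(toB6 (geoCK i □) Rr H, (z,j) ↦ Δ_□(z))` (`w ≥ 0`, `δ ≥ 0`), (2.61) `Ineq261 dB (toB6 (geoCK i □) Rr H) δ α`
  (`α ≤ 1`) and any member kernel `K` with `G₁(Δ_□z)·w(Δ_□z)·B_C·c₁(δ,α)·e^{−(1−α)δ·d(ιBΔ(z),a′)} ≤ K(ιBΔ(z),a′)` for all sites `z` and member blocks `a′`:
  `conj b(M_{g₁}∘R(γ)⁻¹∘M∘R(γ)) ≺ (M₂Σ‖b_j‖)²·K` over the member's `(toB6 (geo9K i) Rr′ Hp, (z,j) ↦ ιB(Δ(z)))`.  NO source cut-off, NO nearness to □.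
* §2 ★★ `hasMajorant_conj_site_sandwich_src_global_decay` — the shape of record: `K_C = B·ℓ_□(a)ⁿ·e^{−δd_□}`, `|g₁|·ℓ_□ᵐ ≤ c₁` (`m ≤ n`) ⟹
  `≺ (M₂Σ‖b‖)²·(c₁·B·c₁(δ,α))·ℓ(a)^{n−m}·e^{−(1−α)δ·d(a,a′)}` in the member's lengths and distance (levels only grow under coarsening: p38's
  `len_cube_le_len_member`) — the source-global twin of p38's `hasMajorant_conj_site_sandwich_decay`.

HONEST SCOPE ∕ NOT CLAIMED.  A carrier-transfer lemma: finite operator algebra + [4] (2.51)∕(2.61) bookkeeping over landed modules; NO printed inequality of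
[B9] is claimed proved by it (the cube-side majorant `hM` is a HYPOTHESIS); family 3 of (3.105) (GAPS G-B9-05) stays open until the FAMTHREE files F3-B∕C land
and their displayed inputs are discharged.  The price of the missing source cut-off is exactly one factor `c₁(δ,α)` and the part `α` of the rate; the two
factors `M₂Σ‖b‖` are the passage `𝔸 ⇄` real coordinates at the two rotations.  Print needs no such transfer (its `G′_□` lives on the cube sequence and its
kernel bounds are pointwise, p. 409 l. 1–5) — this is (R)-design bookkeeping for def-Y's member-level majorants, NOT a statement of the paper.  Inhabited: at
`g₁ = 0` the operator is `0 ≺ (M₂Σ‖b‖)²K`; at `γ = 1`, `g₁ = 1` it is the plain cube→member coarsening of a decaying block majorant — not a vacuous schema.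
NOT a node discharge; no summit ∕ sub-problem statement is proved; nothing continuum ∕ OS ∕ mass-gap ∕ Clay; YM mass gap NOT proved by any of this (Track A
conditional rung).  No `sorry`, no `axiom`, no `… : Prop` fact, no `instance`, no `notation`, no `def`.  NEW file; nothing landed is modified.
`--supports stmt-QuantumFields-19200` as helper.  Net new unproved facts: 0.

RELATED IN THE TREE, NOT DUPLICATED (searched 2026-08-29: `rg 'site_sandwich.*global|sandwich_src_global|SiteSandwichTransferSrc' Literature/…/Balaban1983to89/`
= the bond original only): p38 `B9Cor36BondSandwichTransferSrc.hasMajorant_conj_bond_sandwich_src_global` (bond carrier — the pattern followed; `exp_split_le`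
USED BY NAME), p38 `B9Cor36SiteSandwichTransfer.hasMajorant_conj_site_sandwich` ∕ `_decay` ∕ `_decay_src` (site carrier, source cut-off near □;
`dist_member_le_dist_cube`, `len_cube_le_len_member` USED BY NAME), p21 `B9Cor36CinvCubeLocLetterMajorant.norm_le_sum_mul_of_repr_le` (BY NAME), r05
`B9CubeCoarsening.majorant_transfer_of_nearH` (scalar, near □).
-/

noncomputable section

namespace Literature.MathematicalPhysics.QuantumFieldTheory.Balaban1983to89.B9Cor36SiteSandwichTransferSrcGlobal

open B6RandomWalk (HasMajorant BlockSupp hasMajorant_mono Ineq261 c1_nonneg)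
open B9Thm34Ext (toB6)
open B9Eq39Adjoint (R R_zero)
open B9Eq352DivFormLetters (conj conj_apply coordEquiv coordEquiv_apply coordEquiv_symm_apply norm_coordSymm_apply_le)
open B6KLevelCensusIndexV1 (KIdx)
open B6Cover236MultiLevelBlocks (cubes)
open B6Geom246MultiLevelBox (blkOf)
open B6Ineq2142KLevelV1 (β)
open B9GeoNormsKLevelV1 (geo9K)
open B9CubeLettersBondOpsL0 (BlkCubeY)
open B9Eq360DeltaPrimeACubeY (blkCubeY)
open B9CubeGeometryInputs (geoCK geoCK_len_pos)
open B9Thm37CubeCoverCommutators (cutMulY cutMulY_apply)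
open B9Cor36CinvCubeLocLetterMajorant (norm_le_sum_mul_of_repr_le)
open B9Cor36SiteSandwichTransfer (dist_member_le_dist_cube len_cube_le_len_member)
open B9Cor36BondSandwichTransferSrc (exp_split_le)
open Node00 (SiteY BlkY IBondY conjY conjY_apply toKT)

variable {d ℓ : ℕ} {hd : 1 ≤ d + 1} {hL : Odd (ℓ + 1) ∧ 1 < ℓ + 1} {b₀ b₁ : ℝ}
variable {𝔸 : Type} [NormedRing 𝔸] [NormedAlgebra ℂ 𝔸] [CompleteSpace 𝔸]
variable {ι : Type} [Fintype ι]

/-! ## §1  ★★★ The source-global site sandwich transfer: cube-sequence blocks → member blocks, one (2.61) sum for the splitting of the source block -/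

section Transfer

variable (i : KIdx d ℓ hd hL b₀ b₁) (c : ↥(cubes (toKT i).D.toDomains)) (b : Module.Basis ι ℝ 𝔸)

omit [CompleteSpace 𝔸] in
/-- ★★★ **THE SOURCE-GLOBAL SITE SANDWICH TRANSFER.**  Let `γ` be a bi-contractive unit field on sites (`‖R(γ)a‖, ‖R(γ)⁻¹a‖ ≤ ‖a‖`), `g₁` a real row multiplier
with `|g₁(z)| ≤ G₁(Δ_□(z))`, and let the realified cube-side operator `conj b(M)` on the `𝔸`-valued site functions have the block majorant `B_C·w(a)·e^{−δ·d_□(a,s)}`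
over the cube sequence's blocks `(toB6 (geoCK i □) Rr H, (z,j) ↦ Δ_□(z))` (`w ≥ 0`, `δ ≥ 0`); assume (2.61) on the cube geometry at the splitting exponent `α ≤ 1`
and let the member kernel `K` dominate `G₁(Δ_□z)·w(Δ_□z)·B_C·c₁(δ,α)·e^{−(1−α)δ·d(ιBΔ(z),a′)}` for every site `z` and member block `a′`.  Then
`conj b(M_{g₁}∘R(γ)⁻¹∘M∘R(γ)) ≺ (M₂Σ‖b_j‖)²·K` over the member's blocks `(toB6 (geo9K i) Rr′ Hp, (z,j) ↦ ιB(Δ(z)))`.  Mechanism (verbatim from the bond original):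
a member source in the block `y′` splits into its cube-block pieces (same bound each, `R(γ)` contracts); pieces outside `y′` vanish, the others have
`d(a,y′) ≤ d_□(a,s)` (distances shrink under coarsening), and the splitting costs `Σ_s e^{−αδd_□(a,s)} ≤ c₁`.  NO source cut-off, NO nearness to □ is needed.
A carrier-transfer lemma; no printed inequality is claimed proved by it.
[cite: Balaban1985BackgroundPropagators, Cor. 3.6 p.408 l.11–14, p.409 l.1–5, (3.105) p.414–415; Balaban1984PropagatorsII, (2.51)–(2.52) p.232, (2.46) p.231, Lemma 2.1 (2.61) p.234] -/
theorem hasMajorant_conj_site_sandwich_src_global {M₂ : ℝ} (hM₂ : 0 ≤ M₂) (hrepr : ∀ (v : 𝔸) (j : ι), |b.repr v j| ≤ M₂ * ‖v‖)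
    (γ : SiteY i → 𝔸ˣ) (hγ : ∀ z a, ‖R (γ z) a‖ ≤ ‖a‖ ∧ ‖R (γ z)⁻¹ a‖ ≤ ‖a‖)
    (g₁ : SiteY i → ℝ) (G₁ : BlkCubeY i c → ℝ) (hG₁ : ∀ z, |g₁ z| ≤ G₁ (blkCubeY i c z))
    (ιB : BlkY i → IBondY i) (hι : ∀ s, β i.hN i.D i.hk (ιB s) = s) (Rr : ℝ) (H : Prop) [Fintype (geo9K i).Site] (Rr' : ℝ) (Hp : Prop)
    (dB : ℕ) {BC δ α : ℝ} (hBC : 0 ≤ BC) (hδ : 0 ≤ δ) (hα1 : α ≤ 1) (w : BlkCubeY i c → ℝ) (hw : ∀ s, 0 ≤ w s)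
    (h261 : Ineq261 dB (toB6 (geoCK i c) Rr H) δ α)
    {K : IBondY i → IBondY i → ℝ}
    (hcmp : ∀ (z : SiteY i) (a' : IBondY i),
      G₁ (blkCubeY i c z) * w (blkCubeY i c z) * (BC * B6.c1 dB δ α) *
          Real.exp (-((1 - α) * δ * (geo9K i).dist (ιB (blkOf i.D.toDomains z)) a')) ≤
        K (ιB (blkOf i.D.toDomains z)) a')
    (M : Module.End ℝ (SiteY i → 𝔸))
    (hM : HasMajorant (g := toB6 (geoCK i c) Rr H) (fun p : SiteY i × ι => blkCubeY i c p.1) (conj b M)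
      (fun a s => BC * w a * Real.exp (-(δ * (geoCK i c).dist a s)))) :
    HasMajorant (g := toB6 (geo9K i) Rr' Hp) (fun p : SiteY i × ι => ιB (blkOf i.D.toDomains p.1))
      (conj b ((cutMulY (𝔸 := 𝔸) g₁).restrictScalars ℝ ∘ₗ (conjY γ⁻¹).restrictScalars ℝ ∘ₗ M ∘ₗ (conjY γ).restrictScalars ℝ))
      (fun a a' => (M₂ * ∑ j, ‖b j‖) ^ 2 * K a a') := by
  classical
  intro y' μ B hμ x
  have hSb : 0 ≤ ∑ j, ‖b j‖ := Finset.sum_nonneg fun _ _ => norm_nonneg _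
  -- the source as an `𝔸`-valued site function, rotated; its cube-block pieces
  set lam : SiteY i → 𝔸 := (coordEquiv b).symm μ with hlam
  set ν : SiteY i → 𝔸 := conjY γ lam with hν
  set νs : BlkCubeY i c → SiteY i → 𝔸 := fun s v => if blkCubeY i c v = s then ν v else 0 with hνs
  have hsum : ν = ∑ s, νs s := by
    funext v
    rw [Finset.sum_apply]
    simp only [hνs]
    rw [Finset.sum_ite_eq]
    simp only [Finset.mem_univ, if_true]
  rw [conj_apply]
  simp only [LinearMap.comp_apply, LinearMap.restrictScalars_apply]
  rw [← hlam]
  change |b.repr (cutMulY g₁ (conjY γ⁻¹ (M ν)) x.1) x.2| ≤ (M₂ * ∑ j, ‖b j‖) ^ 2 * K (ιB (blkOf i.D.toDomains x.1)) y' * B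
  rw [cutMulY_apply, conjY_apply, Pi.inv_apply]
  -- the row factor
  have hG₁0 : 0 ≤ G₁ (blkCubeY i c x.1) := (abs_nonneg _).trans (hG₁ x.1)
  have hrowfac : |b.repr ((((g₁ x.1 : ℝ) : ℂ)) • R (γ x.1)⁻¹ (M ν x.1)) x.2| ≤ M₂ * (G₁ (blkCubeY i c x.1) * ‖M ν x.1‖) := by
    refine (hrepr _ _).trans (mul_le_mul_of_nonneg_left ?_ hM₂)
    rw [norm_smul, Complex.norm_real, Real.norm_eq_abs]
    exact mul_le_mul (hG₁ x.1) ((hγ x.1 _).2) (norm_nonneg _) hG₁0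
  -- the source: values bounded by `(Σ‖b‖)·B`, zero off the member block over `y′`
  have hlam_bd : ∀ v, ‖lam v‖ ≤ (∑ j, ‖b j‖) * B := fun v => by
    by_cases hv : ιB (blkOf i.D.toDomains v) = y'
    · rw [hlam]; exact norm_coordSymm_apply_le b μ v B fun j => hμ.bound (v, j) hv
    · have h0 : lam v = 0 := by
        rw [hlam, coordEquiv_symm_apply]
        exact Finset.sum_eq_zero fun j _ => by rw [hμ.off (v, j) hv, zero_smul]
      rw [h0, norm_zero]; exact mul_nonneg hSb hμ.nonneg
  have hlam_off : ∀ v, ιB (blkOf i.D.toDomains v) ≠ y' → lam v = 0 := fun v hv => by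
    rw [hlam, coordEquiv_symm_apply]
    exact Finset.sum_eq_zero fun j _ => by rw [hμ.off (v, j) hv, zero_smul]
  have hν_val : ∀ v, ν v = R (γ v) (lam v) := fun v => by rw [hν, conjY_apply]
  have hν_bd : ∀ v, ‖ν v‖ ≤ (∑ j, ‖b j‖) * B := fun v => by rw [hν_val]; exact ((hγ v _).1).trans (hlam_bd v)
  -- each piece is a cube-side source supported in its cube block
  have hνsupp : ∀ s, BlockSupp (g := toB6 (geoCK i c) Rr H) (fun p : SiteY i × ι => blkCubeY i c p.1) (coordEquiv b (νs s)) s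
      (M₂ * ((∑ j, ‖b j‖) * B)) := fun s => by
    refine ⟨mul_nonneg hM₂ (mul_nonneg hSb hμ.nonneg), fun p hp => ?_, fun p hp => ?_⟩
    · rw [coordEquiv_apply]
      refine (hrepr _ _).trans (mul_le_mul_of_nonneg_left ?_ hM₂)
      simp only [hνs]
      split_ifs
      · exact hν_bd p.1
      · rw [norm_zero]; exact mul_nonneg hSb hμ.nonneg
    · rw [coordEquiv_apply]
      have hp' : ¬ blkCubeY i c p.1 = s := hp
      simp only [hνs, if_neg hp', map_zero, Finsupp.zero_apply]
  -- the cube-side majorant on each piece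
  have hpiece : ∀ s, ‖M (νs s) x.1‖ ≤
      (∑ j, ‖b j‖) * (BC * w (blkCubeY i c x.1) * Real.exp (-(δ * (geoCK i c).dist (blkCubeY i c x.1) s)) *
        (M₂ * ((∑ j, ‖b j‖) * B))) := fun s =>
    norm_le_sum_mul_of_repr_le b _ fun j' => by
      have h := hM s (coordEquiv b (νs s)) _ (hνsupp s) (x.1, j')
      rwa [conj_apply, LinearEquiv.symm_apply_apply] at h
  -- inactive pieces vanish; active pieces lie under `y′`, where `d(a,y′) ≤ d_□(a,s)`
  set Em : ℝ := Real.exp (-((1 - α) * δ * (geo9K i).dist (ιB (blkOf i.D.toDomains x.1)) y')) with hEm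
  have hwB : 0 ≤ BC * w (blkCubeY i c x.1) := mul_nonneg hBC (hw _)
  have hMB : 0 ≤ M₂ * ((∑ j, ‖b j‖) * B) := mul_nonneg hM₂ (mul_nonneg hSb hμ.nonneg)
  have hpiece' : ∀ s, ‖M (νs s) x.1‖ ≤
      (∑ j, ‖b j‖) * (BC * w (blkCubeY i c x.1) * (Em * Real.exp (-(α * δ * (geoCK i c).dist (blkCubeY i c x.1) s))) *
        (M₂ * ((∑ j, ‖b j‖) * B))) := fun s => by
    by_cases hs : ∃ v₀, lam v₀ ≠ 0 ∧ blkCubeY i c v₀ = s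
    · obtain ⟨v₀, hv₀, hs₀⟩ := hs
      have hy' : ιB (blkOf i.D.toDomains v₀) = y' := by
        by_contra h; exact hv₀ (hlam_off v₀ h)
      have hdD := dist_member_le_dist_cube i c ιB hι x.1 v₀
      rw [hs₀, hy'] at hdD
      refine (hpiece s).trans (mul_le_mul_of_nonneg_left (mul_le_mul_of_nonneg_right (mul_le_mul_of_nonneg_left ?_ hwB) hMB) hSb)
      rw [hEm]
      exact exp_split_le hδ hα1 hdD
    · have h0 : νs s = 0 := funext fun v => by
        simp only [hνs]
        split_ifs with hv
        · have hl : lam v = 0 := by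
            by_contra hl; exact hs ⟨v, hl, hv⟩
          rw [hν_val, hl, R_zero]; rfl
        · rfl
      rw [h0, map_zero, Pi.zero_apply, norm_zero]
      exact mul_nonneg hSb (mul_nonneg (mul_nonneg hwB (mul_nonneg (Real.exp_nonneg _) (Real.exp_nonneg _))) hMB)
  -- summing the pieces: one (2.61) sum
  have hMν : M ν x.1 = ∑ s, M (νs s) x.1 := by
    rw [hsum, map_sum, Finset.sum_apply]
  have h261x := h261 (blkCubeY i c x.1)
  have hnorm : ‖M ν x.1‖ ≤ (∑ j, ‖b j‖) * (BC * w (blkCubeY i c x.1) * (Em * B6.c1 dB δ α) * (M₂ * ((∑ j, ‖b j‖) * B))) := by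
    rw [hMν]
    refine (norm_sum_le _ _).trans ((Finset.sum_le_sum fun s _ => hpiece' s).trans ?_)
    have hfac : ∀ s : BlkCubeY i c,
        (∑ j, ‖b j‖) * (BC * w (blkCubeY i c x.1) * (Em * Real.exp (-(α * δ * (geoCK i c).dist (blkCubeY i c x.1) s))) *
          (M₂ * ((∑ j, ‖b j‖) * B))) =
        ((∑ j, ‖b j‖) * (BC * w (blkCubeY i c x.1) * Em * (M₂ * ((∑ j, ‖b j‖) * B)))) *
          Real.exp (-(α * δ * (geoCK i c).dist (blkCubeY i c x.1) s)) := fun s => by ring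
    simp_rw [hfac]
    rw [← Finset.mul_sum]
    calc ((∑ j, ‖b j‖) * (BC * w (blkCubeY i c x.1) * Em * (M₂ * ((∑ j, ‖b j‖) * B)))) *
          ∑ s, Real.exp (-(α * δ * (geoCK i c).dist (blkCubeY i c x.1) s))
        ≤ ((∑ j, ‖b j‖) * (BC * w (blkCubeY i c x.1) * Em * (M₂ * ((∑ j, ‖b j‖) * B)))) * B6.c1 dB δ α :=
          mul_le_mul_of_nonneg_left h261x (mul_nonneg hSb (mul_nonneg (mul_nonneg hwB (Real.exp_nonneg _)) hMB))
      _ = _ := by ring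
  -- assembling
  have hc : G₁ (blkCubeY i c x.1) * w (blkCubeY i c x.1) * (BC * B6.c1 dB δ α) * Em ≤ K (ιB (blkOf i.D.toDomains x.1)) y' :=
    hcmp x.1 y'
  calc |b.repr ((((g₁ x.1 : ℝ) : ℂ)) • R (γ x.1)⁻¹ (M ν x.1)) x.2| ≤ M₂ * (G₁ (blkCubeY i c x.1) * ‖M ν x.1‖) := hrowfac
    _ ≤ M₂ * (G₁ (blkCubeY i c x.1) *
          ((∑ j, ‖b j‖) * (BC * w (blkCubeY i c x.1) * (Em * B6.c1 dB δ α) * (M₂ * ((∑ j, ‖b j‖) * B))))) :=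
        mul_le_mul_of_nonneg_left (mul_le_mul_of_nonneg_left hnorm hG₁0) hM₂
    _ = (M₂ * ∑ j, ‖b j‖) ^ 2 * (G₁ (blkCubeY i c x.1) * w (blkCubeY i c x.1) * (BC * B6.c1 dB δ α) * Em) * B := by ring
    _ ≤ (M₂ * ∑ j, ‖b j‖) ^ 2 * K (ιB (blkOf i.D.toDomains x.1)) y' * B :=
        mul_le_mul_of_nonneg_right (mul_le_mul_of_nonneg_left hc (sq_nonneg _)) hμ.nonneg

end Transfer

/-! ## §2  The shape of record: a decaying cube-side kernel with a length weight, row multiplier `|g₁|·ℓ_□ᵐ ≤ c₁`, no source cut-off -/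

section Decay

variable (i : KIdx d ℓ hd hL b₀ b₁) (c : ↥(cubes (toKT i).D.toDomains)) (b : Module.Basis ι ℝ 𝔸)

omit [CompleteSpace 𝔸] in
/-- ★★ **THE SOURCE-GLOBAL SITE SANDWICH TRANSFER FOR `K_C = B·ℓ_□(a)ⁿ·e^{−δd_□(a,s)}`, ROW MULTIPLIER `|g₁|·ℓ_□ᵐ ≤ c₁` (`m ≤ n`), NO SOURCE CUT-OFF**:
with (2.61) on the cube geometry at the splitting exponent `α ≤ 1`,
`conj b(M_{g₁}∘R(γ)⁻¹∘M∘R(γ)) ≺ (M₂Σ‖b‖)²·(c₁·B·c₁(δ,α))·ℓ(a)^{n−m}·e^{−(1−α)δ·d(a,a′)}` over the member's geometry — levels only grow and distances only shrink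
under coarsening, so the cube-currency bound dominates the member-currency one; the missing source cut-off costs the factor `c₁(δ,α)` and the part `α` of the
rate (the source-global twin of `B9Cor36SiteSandwichTransfer.hasMajorant_conj_site_sandwich_decay`).  A carrier-transfer lemma; no printed inequality is
claimed proved by it.
[cite: Balaban1985BackgroundPropagators, Cor. 3.6 p.408 l.11–14, p.409 l.1–5, Thm 3.1 (3.42) p.397, (3.105) p.414–415; Balaban1984PropagatorsII, (2.51) p.232, (2.46) p.231, Lemma 2.1 (2.61) p.234] -/
theorem hasMajorant_conj_site_sandwich_src_global_decay {M₂ : ℝ} (hM₂ : 0 ≤ M₂) (hrepr : ∀ (v : 𝔸) (j : ι), |b.repr v j| ≤ M₂ * ‖v‖)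
    (γ : SiteY i → 𝔸ˣ) (hγ : ∀ z a, ‖R (γ z) a‖ ≤ ‖a‖ ∧ ‖R (γ z)⁻¹ a‖ ≤ ‖a‖)
    (g₁ : SiteY i → ℝ) {c₁ : ℝ} (hc₁ : 0 ≤ c₁) {m n : ℕ} (hmn : m ≤ n)
    (hg₁ : ∀ z, |g₁ z| * (geoCK i c).len (blkCubeY i c z) ^ m ≤ c₁)
    (ιB : BlkY i → IBondY i) (hι : ∀ s, β i.hN i.D i.hk (ιB s) = s) (Rr : ℝ) (H : Prop) [Fintype (geo9K i).Site] (Rr' : ℝ) (Hp : Prop)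
    (dB : ℕ) {B δ α : ℝ} (hB : 0 ≤ B) (hδ : 0 ≤ δ) (hα1 : α ≤ 1) (h261 : Ineq261 dB (toB6 (geoCK i c) Rr H) δ α)
    (M : Module.End ℝ (SiteY i → 𝔸))
    (hM : HasMajorant (g := toB6 (geoCK i c) Rr H) (fun p : SiteY i × ι => blkCubeY i c p.1) (conj b M)
      (fun a s => B * (geoCK i c).len a ^ n * Real.exp (-(δ * (geoCK i c).dist a s)))) :
    HasMajorant (g := toB6 (geo9K i) Rr' Hp) (fun p : SiteY i × ι => ιB (blkOf i.D.toDomains p.1))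
      (conj b ((cutMulY (𝔸 := 𝔸) g₁).restrictScalars ℝ ∘ₗ (conjY γ⁻¹).restrictScalars ℝ ∘ₗ M ∘ₗ (conjY γ).restrictScalars ℝ))
      (fun a a' => (M₂ * ∑ j, ‖b j‖) ^ 2 * (c₁ * B * B6.c1 dB δ α) * (geo9K i).len a ^ (n - m) *
        Real.exp (-((1 - α) * δ * (geo9K i).dist a a'))) := by
  have hlenpos : ∀ s : BlkCubeY i c, 0 < (geoCK i c).len s := fun s => geoCK_len_pos i c s
  refine hasMajorant_mono (g := toB6 (geo9K i) Rr' Hp) _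
    (hasMajorant_conj_site_sandwich_src_global i c b hM₂ hrepr γ hγ g₁ (fun s => c₁ * ((geoCK i c).len s ^ m)⁻¹) (fun z => ?_)
      ιB hι Rr H Rr' Hp dB hB hδ hα1 (fun s => (geoCK i c).len s ^ n) (fun s => pow_nonneg (hlenpos s).le _) h261
      (K := fun a a' => (c₁ * B * B6.c1 dB δ α) * (geo9K i).len a ^ (n - m) * Real.exp (-((1 - α) * δ * (geo9K i).dist a a')))
      (fun z a' => ?_) M hM)
    fun a a' => le_of_eq (by ring)
  · -- `|g₁ z| ≤ c₁·ℓ_□(Δ_□z)⁻ᵐ`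
    rw [← div_eq_mul_inv, le_div_iff₀ (pow_pos (hlenpos _) m)]
    exact hg₁ z
  · -- the comparison at the row site `z`: `ℓ_□ⁿ·ℓ_□⁻ᵐ = ℓ_□^{n−m} ≤ ℓ^{n−m}`
    have hlx := hlenpos (blkCubeY i c z)
    have hLC := len_cube_le_len_member i c ιB hι z
    have hpow : (geoCK i c).len (blkCubeY i c z) ^ n * ((geoCK i c).len (blkCubeY i c z) ^ m)⁻¹ = (geoCK i c).len (blkCubeY i c z) ^ (n - m) := by
      rw [pow_sub₀ _ hlx.ne' hmn]
    have hpw : (geoCK i c).len (blkCubeY i c z) ^ (n - m) ≤ (geo9K i).len (ιB (blkOf i.D.toDomains z)) ^ (n - m) :=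
      pow_le_pow_left₀ hlx.le hLC _
    have hpre : 0 ≤ c₁ * B * B6.c1 dB δ α := mul_nonneg (mul_nonneg hc₁ hB) (c1_nonneg _ _ _)
    calc c₁ * ((geoCK i c).len (blkCubeY i c z) ^ m)⁻¹ * (geoCK i c).len (blkCubeY i c z) ^ n * (B * B6.c1 dB δ α) *
          Real.exp (-((1 - α) * δ * (geo9K i).dist (ιB (blkOf i.D.toDomains z)) a'))
        = (c₁ * B * B6.c1 dB δ α) * ((geoCK i c).len (blkCubeY i c z) ^ n * ((geoCK i c).len (blkCubeY i c z) ^ m)⁻¹) *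
          Real.exp (-((1 - α) * δ * (geo9K i).dist (ιB (blkOf i.D.toDomains z)) a')) := by ring
      _ = (c₁ * B * B6.c1 dB δ α) * (geoCK i c).len (blkCubeY i c z) ^ (n - m) *
          Real.exp (-((1 - α) * δ * (geo9K i).dist (ιB (blkOf i.D.toDomains z)) a')) := by rw [hpow]
      _ ≤ (c₁ * B * B6.c1 dB δ α) * (geo9K i).len (ιB (blkOf i.D.toDomains z)) ^ (n - m) *
          Real.exp (-((1 - α) * δ * (geo9K i).dist (ιB (blkOf i.D.toDomains z)) a')) :=
          mul_le_mul_of_nonneg_right (mul_le_mul_of_nonneg_left hpw hpre) (Real.exp_nonneg _)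

end Decay

end Literature.MathematicalPhysics.QuantumFieldTheory.Balaban1983to89.B9Cor36SiteSandwichTransferSrcGlobal

end
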